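import Summits.HodgeConjecture.HodgeConjecture.Theorems.WeilTypeLadderOnPath
import Literature.AlgebraicGeometry.HodgeTheory.WeilClassesTensorPointQuartic
import HarnessLib

/-!
# Weil-type ladder — rung R3 (`WeilClassesCMField`) holds UNCONDITIONALLY at the companion tensor points of EVERY quartic field

B2b ladder `hodge-weil` (HOME `run/shared/lean/b2b/hodge-weil/`, CENSUS ## P3-g5 addendum "companion tensor points"), prover 3
generation 5 (classical tools). Helper of the route item `WeilSixfolds` (R1, stmt-HodgeConjecture-2524) for the ladder's THIRD rung,
exactly in the shape of `WeilTypeLadderZetaEight` (pv3-g4, `E = ℚ(ζ₈)`), now for EVERY monic quartic `P ∈ ℤ[x]` with four distinct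
complex roots: on `A = (T × T) × (T × T)` with the companion endomorphism `φ_P` (`HodgeTheory/WeilClassesTensorPointQuartic`,
Deligne's `A₀ ⊗ ℤ[x]/(P)` with its `x`-action) ALL Weil classes `weilClassesField A φ_P P' (2g)` are algebraic — the tree's PROVED
theorem `weilClassesField_companionFour_le_algebraicClasses` (Deligne LNM 900 Lemma 4.5 / Remark 4.10 for every quartic `E`, fact-free,
via the general companion-structure theorems of `HodgeTheory/WeilClassesTensorPointField(Lines)`).

## What is typed here (all unconditional; no definition, no named fact, no sorry)

* `weilClassesCMField_body_companionFour`: R3 = `WeilClassesCMField` AT `(A, φ_P)` in the rung's literal binder shape with `m = g`,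
  for every `T ∈ 𝒜_g` (`g ≥ 1`) and every quartic `P` with distinct roots `r₀..r₃` (every rung hypothesis other than membership in
  `weilClassesField` is carried unused);
* `weilClassesCMField_body_zetaFive`: the case `P = x⁴ + x³ + x² + x + 1`, `E = ℚ(ζ₅)` — a NEW field on the R3 census
  (`ℚ(ζ₈)`: `WeilTypeLadderZetaEight`);
* ON-PATH: `HodgeConjecture ⟹` the same statements (`…_of_hodgeConjecture`, via `weilClassesCMField_of_hodgeConjecture`).

Honest scope: `g(g+1)/2`-dimensional special loci `{T ⊗ E}` of the R3 components; 0 unconditional RUNGS above the floor.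
-/

noncomputable section

open CategoryTheory

-- `Summit.HodgeConjecture.HodgeConjecture.…` is the mandated namespace (single-problem summit: Problem = Summit), which
-- `linter.dupNamespace` flags on every declaration; the lakefile turns the linter off tree-wide (weak option), restated here so
-- stand-alone elaboration is warning-free too.
set_option linter.dupNamespace false

namespace Summit.HodgeConjecture.HodgeConjecture.WeilTypeLadder

open Literature.AlgebraicTopology.SingularHomology
open Literature.AlgebraicGeometry.HodgeTheory
open Literature.AlgebraicGeometry.Motives

variable {T : AbelianVariety ℂ} {g : ℕ}

/-- **R3 (`WeilClassesCMField`) holds UNCONDITIONALLY at the companion tensor point `((T × T) × (T × T), φ_P)`** for every `T ∈ 𝒜_g`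
(`g ≥ 1`) and every monic quartic `P = x⁴ + a₃x³ + a₂x² + a₁x + a₀ ∈ ℤ[x]` with four distinct complex roots `r`, in the rung's literal
binder shape with `m = g`: every class of `weilClassesField A φ_P P' (2g)` is algebraic (all other rung hypotheses carried, unused).
[cite: Deligne1982HodgeCycles, §4 Lemma 4.5, Remark 4.10] [cite: MoonenZarhin1998WeilClasses, §1] -/
theorem weilClassesCMField_body_companionFour (hg : 0 < g) (hT : T.dim = g) (a : Fin 4 → ℤ) {r : Fin 4 → ℂ}
    (hr : Function.Injective r) (hroot : ∀ k, r k ^ 4 + ∑ j : Fin 4, (a j : ℂ) * r k ^ (j : ℕ) = 0) :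
    let A := (T.prod T).prod (T.prod T)
    ∀ (P' : Polynomial ℤ) (e : ℕ),
      P'.Monic → P'.natDegree = e → 2 < e → Irreducible (P'.map (Int.castRingHom ℚ)) →
      Polynomial.eval₂ (Int.castRingHom (CategoryTheory.End A)) (companionFour T a : CategoryTheory.End A) P' = 0 →
      e * (2 * g) = 2 * A.dim →
      (∀ ρ : ℂ, Polynomial.eval₂ (Int.castRingHom ℂ) ρ P' = 0 → starRingEnd ℂ ρ ≠ ρ) →
      (∃ Q : Polynomial ℚ, ∀ ρ : ℂ, Polynomial.eval₂ (Int.castRingHom ℂ) ρ P' = 0 →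
          Polynomial.eval₂ (algebraMap ℚ ℂ) ρ Q = starRingEnd ℂ ρ) →
        ∀ c ∈ weilClassesField A (companionFour T a) P' (2 * g), IsRationalClass c →
          IsOfHodgeType A.dim A.X (2 * g) g g c → c ∈ algebraicClasses A.X g :=
  fun P' _ _ _ _ _ _ _ _ _ _ hc _ _ => weilClassesField_companionFour_le_algebraicClasses hg hT a hr hroot P' hc

/-- **R3 holds UNCONDITIONALLY at `T ⊗ ℤ[ζ₅]`** (`P = x⁴ + x³ + x² + x + 1`, `E = ℚ(ζ₅)` a CM field of degree `4 > 2`), for every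
`T ∈ 𝒜_g`, `g ≥ 1`, in the rung's literal binder shape with `m = g`. [cite: Deligne1982HodgeCycles, §4 Lemma 4.5, Remark 4.10] -/
theorem weilClassesCMField_body_zetaFive (hg : 0 < g) (hT : T.dim = g) :
    let A := (T.prod T).prod (T.prod T)
    ∀ (P' : Polynomial ℤ) (e : ℕ),
      P'.Monic → P'.natDegree = e → 2 < e → Irreducible (P'.map (Int.castRingHom ℚ)) →
      Polynomial.eval₂ (Int.castRingHom (CategoryTheory.End A)) (companionFour T (fun _ => 1) : CategoryTheory.End A) P' = 0 →
      e * (2 * g) = 2 * A.dim →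
      (∀ ρ : ℂ, Polynomial.eval₂ (Int.castRingHom ℂ) ρ P' = 0 → starRingEnd ℂ ρ ≠ ρ) →
      (∃ Q : Polynomial ℚ, ∀ ρ : ℂ, Polynomial.eval₂ (Int.castRingHom ℂ) ρ P' = 0 →
          Polynomial.eval₂ (algebraMap ℚ ℂ) ρ Q = starRingEnd ℂ ρ) →
        ∀ c ∈ weilClassesField A (companionFour T fun _ => 1) P' (2 * g), IsRationalClass c →
          IsOfHodgeType A.dim A.X (2 * g) g g c → c ∈ algebraicClasses A.X g :=
  fun P' _ _ _ _ _ _ _ _ _ _ hc _ _ => weilClassesField_zetaFive_le_algebraicClasses hg hT P' hc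

/-- ON-PATH: `HodgeConjecture ⟹` the R3-body statement at the companion tensor point `((T × T) × (T × T), φ_P)` (a case of the summit,
through `weilClassesCMField_of_hodgeConjecture`; here for ANY `a`, no root hypothesis). -/
theorem weilClassesCMField_body_companionFour_of_hodgeConjecture (h : _root_.HodgeConjecture) (a : Fin 4 → ℤ) :
    let A := (T.prod T).prod (T.prod T)
    ∀ (P' : Polynomial ℤ) (e : ℕ),
      P'.Monic → P'.natDegree = e → 2 < e → Irreducible (P'.map (Int.castRingHom ℚ)) →
      Polynomial.eval₂ (Int.castRingHom (CategoryTheory.End A)) (companionFour T a : CategoryTheory.End A) P' = 0 →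
      e * (2 * g) = 2 * A.dim →
      (∀ ρ : ℂ, Polynomial.eval₂ (Int.castRingHom ℂ) ρ P' = 0 → starRingEnd ℂ ρ ≠ ρ) →
      (∃ Q : Polynomial ℚ, ∀ ρ : ℂ, Polynomial.eval₂ (Int.castRingHom ℂ) ρ P' = 0 →
          Polynomial.eval₂ (algebraMap ℚ ℂ) ρ Q = starRingEnd ℂ ρ) →
        ∀ c ∈ weilClassesField A (companionFour T a) P' (2 * g), IsRationalClass c →
          IsOfHodgeType A.dim A.X (2 * g) g g c → c ∈ algebraicClasses A.X g := by
  intro A P' e hmon hdeg he hirr hev hdim hnr hQ c hc hrat hhodge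
  exact weilClassesCMField_of_hodgeConjecture h A (companionFour T a) P' e g hmon hdeg he hirr hev hdim hnr hQ c hc hrat hhodge

end Summit.HodgeConjecture.HodgeConjecture.WeilTypeLadder

end
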